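import Summits.RiemannHypothesis.RiemannHypothesis.Theorems.SemilocalNegCertPieces
import HarnessLib

/-!
# Semi-local thresholds, negative side (IIIc): the piecewise certificate on WIDE windows `b ≤ 4`

Cell `rh-explicit` (HOME `run/shared/lean/pub/rh-explicit/`), seat cc-s2-4 gen8 (A4-EXT, the Lean side: theorem upper ends for
the walls `q = 53 … 73`, whose thresholds `a*(S_q) = 1.985 … 2.145` lie beyond the scope `b ≤ 2` of `WeilNegCertP`
(`SemilocalNegCertPieces.lean`)).  Honest framing: theorems about the tree's `weilSemilocalThreshold S`; nothing here bears on
RH.  No data is trusted.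

Two ingredients of `WeilNegCertP` carry the bound `b ≤ 2`: the centred archimedean majorant uses `e^{t/2} = (e^{t/4})² ≤ E_n(t/4)²`
(valid for `t ≤ 4`, `SemilocalArchMajorantCentred.lean`), and the polar credit `mellinOneLowerQ ≤ |Ĝ(1)|` (`SemilocalNegTerms.lean`,
Maclaurin remainder on `|x| ≤ b ≤ 2`).  Here

* `archMajorWL n m K u₀` = `(1/(2(1+u₀))) · E_n(t/8)⁴ · A_m((u_K(t) − u₀)/(1+u₀))` majorises `t·w(t)` on `(0, 8]`
  (`mul_weilArchDensity_le_wide`), `pieceWQ` / THEOREM B‴ (`setIntegral_weilArchDensity_mul_le_pieceW`) and `piecesW_bound`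
  are the piece bounds with `T ≤ 8`;
* the certificate check DROPS the polar credit (it is a credit: `Re Q_S(G) ≤ … − 2|Ĝ(1)|² ≤ …` only helps, so omitting it is
  sound and costs what it costs): `WeilNegCertP.checkPieceW i`, `checkMainW c₀` (`b ≤ 4`, final inequality
  `A + Σ B_i + 2N·T < (c₀ + 2Σ wlo)·N`), SOUNDNESS `weilSemilocalThreshold_le_of_checkW[_sharp]`:
  `AtomsEnclose S N c.atoms c.logSuccLo → checkMainW → checkAtoms → (∀ i < r, checkPieceW i) → a*(S) ≤ c.b`.

The data structure is the SAME `WeilNegCertP` (the field `ne` is unused here).  Folklore throughout.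
-/

set_option autoImplicit false
set_option linter.dupNamespace false  -- the mandated namespace repeats `RiemannHypothesis`

noncomputable section

open Complex Filter Set MeasureTheory Topology
open scoped Real

namespace Summit.RiemannHypothesis.RiemannHypothesis.Theorems.SemilocalPolyWitness

open MeasureTheory Set Finset Real
open Literature.NumberTheory.LFunctions
open Summit.RiemannHypothesis.RiemannHypothesis.Theorems.MotivicDoor
open Summit.RiemannHypothesis.RiemannHypothesis.Theorems.MotivicDoor.SemilocalThreshold
open Summit.RiemannHypothesis.RiemannHypothesis.Theorems.MotivicDoor.SemilocalMarkov
open LQ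

/-! ## The wide centred majorant of `t·w(t)` on `(0, 8]` -/

/-- **The wide centred majorant list** `archMajorWL n m K u₀`: coefficients of
`(1/(2(1+u₀))) · E_n(t/8)⁴ · A_m((u_K(t) − u₀)/(1+u₀))`. -/
def archMajorWL (n m K : ℕ) (u0 : ℚ) : List ℚ :=
  smul (1 / (2 * (1 + u0))) (mul (pow (expUpScaledL n (1 / 8)) 4) (geomL (2 * m + 1) (centredL K u0)))

/-- `ev (archMajorWL n m K u₀) t = (1/(2(1+u₀))) · E_n(t/8)⁴ · A_m((u_K(t) − u₀)/(1+u₀))`. -/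
theorem ev_archMajorWL (n m K : ℕ) (u0 : ℚ) (t : ℝ) :
    ev (archMajorWL n m K u0) t =
      1 / (2 * (1 + u0)) * expUp n (t / 8) ^ 4 * geomAlt m ((uSum K t - u0) / (1 + u0)) := by
  rw [archMajorWL, ev_smul, ev_mul, ev_pow, ev_expUpScaledL, ev_geomL, ev_centredL, geomAlt]
  push_cast
  ring

/-- **LEMMA A″ — wide centred polynomial majorant of `t·w(t)`**: for `0 < t ≤ 8`, `n ≥ 1` and a rational
`0 ≤ u₀ ≤ u_K(t)`, `t · w(t) ≤ ev (archMajorWL n m K u₀) t`. -/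
theorem mul_weilArchDensity_le_wide (n m K : ℕ) (hn : 0 < n) {u0 : ℚ} (hu0 : 0 ≤ u0) {t : ℝ} (ht : 0 < t)
    (ht8 : t ≤ 8) (hu : (u0 : ℝ) ≤ uSum K t) : t * weilArchDensity t ≤ ev (archMajorWL n m K u0) t := by
  rw [ev_archMajorWL]
  have hsinh : 0 < Real.sinh t := Real.sinh_pos_iff.2 ht
  have hu0' : (0 : ℝ) ≤ u0 := by exact_mod_cast hu0
  set x : ℝ := (uSum K t - u0) / (1 + u0) with hx
  have hx0 : 0 ≤ x := div_nonneg (by linarith) (by linarith)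
  have h1 : t / Real.sinh t ≤ 1 / (1 + uSum K t) := by
    rw [div_le_div_iff₀ hsinh (by linarith [uSum_nonneg K ht.le]), one_mul]
    exact mul_one_add_uSum_le_sinh K ht.le
  have h1' : 1 / (1 + uSum K t) = 1 / (1 + u0) * (1 / (1 + x)) := by
    rw [hx]
    field_simp
    ring
  have h2 : t / Real.sinh t ≤ 1 / (1 + u0) * geomAlt m x := by
    rw [h1'] at h1
    exact h1.trans (mul_le_mul_of_nonneg_left (inv_one_add_le_geomAlt m hx0) (by positivity))
  -- e^{t/2} ≤ E_n(t/8)⁴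
  have h3 : Real.exp (t / 8) ≤ expUp n (t / 8) := exp_le_expUp hn (by linarith) (by linarith)
  have h4 : Real.exp (t / 2) ≤ expUp n (t / 8) ^ 4 := by
    rw [show Real.exp (t / 2) = Real.exp (t / 8) ^ 4 by rw [← Real.exp_nat_mul]; ring_nf]
    exact pow_le_pow_left₀ (Real.exp_pos _).le h3 4
  have e : t * weilArchDensity t = 1 / 2 * Real.exp (t / 2) * (t / Real.sinh t) := by
    unfold weilArchDensity
    field_simp
  rw [e]
  have hts : 0 ≤ t / Real.sinh t := by positivity
  have hE4 : 0 ≤ expUp n (t / 8) ^ 4 := (Real.exp_pos _).le.trans h4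
  calc 1 / 2 * Real.exp (t / 2) * (t / Real.sinh t)
      ≤ 1 / 2 * expUp n (t / 8) ^ 4 * (t / Real.sinh t) := by gcongr
    _ ≤ 1 / 2 * expUp n (t / 8) ^ 4 * (1 / (1 + u0) * geomAlt m x) := by gcongr
    _ = 1 / (2 * (1 + ↑u0)) * expUp n (t / 8) ^ 4 * geomAlt m x := by
        field_simp

/-! ## THEOREM B‴: the bulk integral on one piece `(T₀, T₁]`, `T₁ ≤ 8` -/

/-- The rational wide piece bound: `[∫ archMajorWL·q]_{T₀}^{T₁}` with the majorant centred at `u₀ = u_K(T₀)`. -/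
def pieceWQ (n m K : ℕ) (q : List ℚ) (T0 T1 : ℚ) : ℚ :=
  evQ (integ (mul (archMajorWL n m K (evQ (uSumL K) T0)) q)) T1 -
    evQ (integ (mul (archMajorWL n m K (evQ (uSumL K) T0)) q)) T0

/-- **THEOREM B‴.**  Let `0 ≤ T₀ < T₁ ≤ 8` be rationals and let `D` agree on `(T₀, T₁]` with `t · q(t)`, `q ≥ 0` there.
Then `w·D` is integrable on `(T₀, T₁]` and `∫_{(T₀,T₁]} w·D ≤ pieceWQ n m K q T₀ T₁`. -/
theorem setIntegral_weilArchDensity_mul_le_pieceW {q : List ℚ} {D : ℝ → ℝ} {T0 T1 : ℚ} (hT0 : 0 ≤ T0)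
    (hT01 : T0 < T1) (hT8 : (T1 : ℝ) ≤ 8)
    (hD : ∀ t ∈ Ioc (T0 : ℝ) T1, D t = t * ev q t) (hq : ∀ t ∈ Ioc (T0 : ℝ) T1, 0 ≤ ev q t)
    (n m K : ℕ) (hn : 0 < n) :
    IntegrableOn (fun t ↦ weilArchDensity t * D t) (Ioc (T0 : ℝ) T1) ∧
      ∫ t in Ioc (T0 : ℝ) T1, weilArchDensity t * D t ≤ ((pieceWQ n m K q T0 T1 : ℚ) : ℝ) := by
  have hT0' : (0 : ℝ) ≤ T0 := by exact_mod_cast hT0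
  have hT01' : (T0 : ℝ) < T1 := by exact_mod_cast hT01
  set u0 : ℚ := evQ (uSumL K) T0 with hu0def
  have hu0R : (u0 : ℝ) = uSum K T0 := by rw [hu0def, ← ev_ratCast, ev_uSumL]
  have hu0 : 0 ≤ u0 := by
    have h := uSum_nonneg K hT0'
    rw [← hu0R] at h
    exact_mod_cast h
  set Mj : ℝ → ℝ := fun t ↦ ev (mul (archMajorWL n m K u0) q) t with hM
  set P : ℝ → ℝ := fun t ↦ weilArchDensity t * (t * ev q t) with hP
  have hMc : Continuous Mj := continuous_ev _
  have hMi : IntegrableOn Mj (Ioc (T0 : ℝ) T1) :=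
    (hMc.integrableOn_Icc (a := (T0 : ℝ)) (b := (T1 : ℝ))).mono_set Ioc_subset_Icc_self
  have hEq : EqOn (fun t ↦ weilArchDensity t * D t) P (Ioc (T0 : ℝ) T1) := fun t ht ↦ by
    simp only [hP, hD t ht]
  have hpt : ∀ t ∈ Ioc (T0 : ℝ) T1, 0 ≤ P t ∧ P t ≤ Mj t := by
    intro t ht
    have ht0 : 0 < t := lt_of_le_of_lt hT0' ht.1
    have hw := weilArchDensity_pos ht0
    have hqt := hq t ht
    refine ⟨mul_nonneg hw.le (mul_nonneg ht0.le hqt), ?_⟩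
    rw [hM, hP]
    simp only
    rw [ev_mul, show weilArchDensity t * (t * ev q t) = (t * weilArchDensity t) * ev q t by ring]
    refine mul_le_mul_of_nonneg_right ?_ hqt
    refine mul_weilArchDensity_le_wide n m K hn hu0 ht0 (ht.2.trans hT8) ?_
    rw [hu0R]
    exact uSum_mono K hT0' ht.1.le
  have hPm : AEStronglyMeasurable P (volume.restrict (Ioc (T0 : ℝ) T1)) := by
    have : Measurable P := by
      rw [hP]
      exact measurable_weilArchDensity.mul (measurable_id.mul (continuous_ev q).measurable)
    exact this.aestronglyMeasurable
  have hPint : IntegrableOn P (Ioc (T0 : ℝ) T1) := by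
    refine Integrable.mono' hMi hPm ?_
    filter_upwards [ae_restrict_mem measurableSet_Ioc] with t ht
    rw [Real.norm_eq_abs, abs_of_nonneg (hpt t ht).1]
    exact (hpt t ht).2
  have hint : IntegrableOn (fun t ↦ weilArchDensity t * D t) (Ioc (T0 : ℝ) T1) :=
    hPint.congr_fun hEq.symm measurableSet_Ioc
  refine ⟨hint, ?_⟩
  calc ∫ t in Ioc (T0 : ℝ) T1, weilArchDensity t * D t
      = ∫ t in Ioc (T0 : ℝ) T1, P t := setIntegral_congr_fun measurableSet_Ioc hEq
    _ ≤ ∫ t in Ioc (T0 : ℝ) T1, Mj t := setIntegral_mono_on hPint hMi measurableSet_Ioc fun t ht ↦ (hpt t ht).2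
    _ = ∫ t in (T0 : ℝ)..T1, Mj t := (intervalIntegral.integral_of_le hT01'.le).symm
    _ = ((pieceWQ n m K q T0 T1 : ℚ) : ℝ) := by
        rw [hM, integral_ev, pieceWQ, ev_ratCast, ev_ratCast]
        push_cast
        rfl

/-- **The wide bulk bound over the pieces** (induction on the cut list, `T_r ≤ 8`). -/
theorem piecesW_bound (n m K : ℕ) (hn : 0 < n) {q : List ℚ} {D : ℝ → ℝ} :
    ∀ (T0 : ℚ) (cuts B : List ℚ), 0 ≤ T0 → cutsOk T0 cuts = true → (lastCut T0 cuts : ℝ) ≤ 8 →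
      B.length = cuts.length →
      (∀ t ∈ Ioc (T0 : ℝ) (lastCut T0 cuts), D t = t * ev q t) →
      (∀ t ∈ Ioc (T0 : ℝ) (lastCut T0 cuts), 0 ≤ ev q t) →
      (∀ i, i < cuts.length → pieceWQ n m K q ((T0 :: cuts).getD i 0) (cuts.getD i 0) ≤ B.getD i 0) →
      IntegrableOn (fun t ↦ weilArchDensity t * D t) (Ioc (T0 : ℝ) (lastCut T0 cuts)) ∧
        ∫ t in Ioc (T0 : ℝ) (lastCut T0 cuts), weilArchDensity t * D t ≤ ((sumQ B : ℚ) : ℝ)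
  | T0, [], B, _, _, _, hlen, _, _, _ => by
      have hB : B = [] := List.length_eq_zero_iff.1 (by simpa using hlen)
      subst hB
      simp [lastCut, sumQ]
  | T0, T1 :: rest, B, hT0, hcuts, h8, hlen, hD, hq, hB => by
      obtain ⟨B0, Brest, rfl⟩ : ∃ B0 Brest, B = B0 :: Brest := by
        cases B with
        | nil => simp at hlen
        | cons a l => exact ⟨a, l, rfl⟩
      simp only [cutsOk, Bool.and_eq_true, decide_eq_true_eq] at hcuts
      obtain ⟨h01, hrest⟩ := hcuts
      simp only [lastCut] at h8 hD hq ⊢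
      have hlen' : Brest.length = rest.length := by simpa using hlen
      have hT1last : (T1 : ℝ) ≤ lastCut T1 rest := by exact_mod_cast le_lastCut T1 rest hrest
      have hT01' : (T0 : ℝ) ≤ T1 := by exact_mod_cast h01.le
      have hpiece := setIntegral_weilArchDensity_mul_le_pieceW (q := q) (D := D) hT0 h01 (hT1last.trans h8)
        (fun t ht ↦ hD t ⟨ht.1, ht.2.trans hT1last⟩) (fun t ht ↦ hq t ⟨ht.1, ht.2.trans hT1last⟩) n m K hn
      have hB0 : pieceWQ n m K q T0 T1 ≤ B0 := by simpa using hB 0 (by simp)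
      have hrec := piecesW_bound n m K hn T1 rest Brest (hT0.trans h01.le) hrest h8 hlen'
        (fun t ht ↦ hD t ⟨lt_of_le_of_lt hT01' ht.1, ht.2⟩) (fun t ht ↦ hq t ⟨lt_of_le_of_lt hT01' ht.1, ht.2⟩)
        (fun i hi ↦ by simpa using hB (i + 1) (by simpa using hi))
      have hunion : Ioc (T0 : ℝ) T1 ∪ Ioc (T1 : ℝ) (lastCut T1 rest) = Ioc (T0 : ℝ) (lastCut T1 rest) :=
        Ioc_union_Ioc_eq_Ioc hT01' hT1last
      rw [← hunion]
      refine ⟨hpiece.1.union hrec.1, ?_⟩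
      rw [setIntegral_union (Ioc_disjoint_Ioc_of_le le_rfl) measurableSet_Ioc hpiece.1 hrec.1, sumQ]
      push_cast
      have h1 : ((pieceWQ n m K q T0 T1 : ℚ) : ℝ) ≤ B0 := by exact_mod_cast hB0
      linarith [hpiece.2, hrec.2]

/-! ## The wide certificate checks (same data structure `WeilNegCertP`; no polar credit) -/

namespace WeilNegCertP

variable (c : WeilNegCertP)

/-- Kernel fact `i` (wide): the `i`-th piece integral is at most the claimed `B_i`. -/
def checkPieceW (i : ℕ) : Bool :=
  decide (pieceWQ c.nA c.mA c.KA c.q ((0 :: c.cuts).getD i 0) (c.cuts.getD i 0) ≤ c.pieceB.getD i 0)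

/-- Lower bound of the right side WITHOUT the polar credit, given `c₀ ≤ C_∅`. -/
def rhsWQ (c0 : ℚ) : ℚ := (c0 + 2 * atomWloSum c.atoms) * LQ.normSq c.p c.b

/-- Kernel fact (wide): side conditions (`b ≤ 4`) and the final strict inequality from the CLAIMED bounds. -/
def checkMainW (c0 : ℚ) : Bool :=
  isOddList c.p && decide (0 < c.b) && decide (c.b ≤ 4) &&
    decide (0 < c.nA) && decide (0 < c.nt) &&
    decide ((incrementL c.p c.b).headD 0 = 0) && decide (invPartialExpQ c.nt (2 * (2 * c.b)) < 1) &&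
    atomsOk (2 * c.b) c.atoms && decide (2 * c.b < c.logSuccLo) &&
    cutsOk 0 c.cuts && decide (lastCut 0 c.cuts = 2 * c.b) && decide (c.pieceB.length = c.cuts.length) &&
    decide (c.atomB + sumQ c.pieceB + 2 * LQ.normSq c.p c.b * archTailQ (2 * c.b) c.Kt c.nt < c.rhsWQ c0)

end WeilNegCertP

/-- **SOUNDNESS of the wide certificate.** -/
theorem weilSemilocalThreshold_le_of_checkW (c : WeilNegCertP) {S : Finset ℕ} {N : ℕ} {c0 : ℚ}
    (henc : AtomsEnclose S N c.atoms c.logSuccLo) (hc0 : (c0 : ℝ) ≤ semilocalEmptyConstant)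
    (hmain : c.checkMainW c0 = true) (hat : c.checkAtoms = true)
    (hpieces : ∀ i, i < c.cuts.length → c.checkPieceW i = true) :
    weilSemilocalThreshold S ≤ (c.b : ℝ) := by
  simp only [WeilNegCertP.checkMainW, Bool.and_eq_true, decide_eq_true_eq] at hmain
  obtain ⟨⟨⟨⟨⟨⟨⟨⟨⟨⟨⟨⟨hodd, hb0⟩, hb4⟩, hnA⟩, hnt⟩, hhead⟩, htail1⟩, hatoms⟩, hsucc⟩, hcuts⟩, hlast⟩,
    hlen⟩, hfinal⟩ := hmain
  simp only [WeilNegCertP.checkAtoms, decide_eq_true_eq] at hat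
  simp only [WeilNegCertP.checkPieceW, decide_eq_true_eq] at hpieces
  rw [atomsOk_iff] at hatoms
  obtain ⟨hnodup, hsub, hcover, hencl, hlogSucc⟩ := henc
  set p := c.p
  set b := c.b
  have hb0' : (0 : ℝ) < b := by exact_mod_cast hb0
  have hbwin : (b : ℝ) < Real.log ((N : ℝ) + 1) / 2 := by
    have h1 : ((2 * b : ℚ) : ℝ) < c.logSuccLo := by exact_mod_cast hsucc
    push_cast at h1
    linarith
  set G := polyWitness p b with hG
  have hW := isMarkovWitness_polyWitness (p := p) (b := b) hodd hb0
  set inc := incrementL p b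
  set Nm : ℝ := (LQ.normSq p b : ℝ)
  have hN : ∫ x, ‖G x‖ ^ 2 = Nm := integral_norm_sq_polyWitness (p := p) hb0
  have hN0 : 0 ≤ Nm := by rw [← hN]; exact integral_nonneg fun x ↦ by positivity
  -- D on (0, 2b]
  have hDev : ∀ t ∈ Set.Ioc (0 : ℝ) ((2 * b : ℚ) : ℝ), weilIncrement G t = ev inc t := fun t ht ↦
    weilIncrement_polyWitness_eq_ev hodd hb0 ht.1.le (by push_cast at ht; exact ht.2)
  have hDq : ∀ t ∈ Set.Ioc (0 : ℝ) ((2 * b : ℚ) : ℝ), weilIncrement G t = t * ev c.q t := fun t ht ↦ by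
    rw [hDev t ht, ev_eq_headD_add_tail, hhead]
    push_cast
    rw [zero_add]
    rfl
  have hq : ∀ t ∈ Set.Ioc (0 : ℝ) ((2 * b : ℚ) : ℝ), 0 ≤ ev c.q t := fun t ht ↦ by
    have h1 := weilIncrement_nonneg G t
    rw [hDq t ht] at h1
    exact (mul_nonneg_iff_of_pos_left ht.1).1 h1
  -- atoms
  have hAt : semilocalAtomEnergy S N G ≤ (c.atomB : ℝ) := by
    unfold semilocalAtomEnergy
    rw [sum_range_eq_atoms_sum (h := fun n ↦ weilSemilocalCoeff S n * weilIncrement G (Real.log n)) hnodup hsub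
      (fun n hn hnot ↦ by rw [hcover n hn hnot, zero_mul])]
    refine (atoms_sum_le_atomLhsQ inc c.atoms (fun na hna ↦ (hencl na hna).2.2.2) (fun na hna ↦ ?_)).trans
      (by exact_mod_cast hat)
    obtain ⟨hlo0, _, hhiT⟩ := hatoms na hna
    obtain ⟨hlo, hhi, _, _⟩ := hencl na hna
    have hmem : Real.log na.1 ∈ Set.Ioc (0 : ℝ) ((2 * b : ℚ) : ℝ) :=
      ⟨lt_of_lt_of_le (by exact_mod_cast hlo0) hlo, hhi.trans (by exact_mod_cast hhiT)⟩
    refine ⟨weilIncrement_nonneg G _, ?_⟩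
    rw [hDev _ hmem]
    exact ev_le_evalUpperQ inc hlo (by push_cast; linarith)
  -- bulk over the pieces
  have hlastR : ((lastCut 0 c.cuts : ℚ) : ℝ) = ((2 * b : ℚ) : ℝ) := by rw [hlast]
  have h8 : ((lastCut 0 c.cuts : ℚ) : ℝ) ≤ 8 := by
    rw [hlastR]; push_cast
    have : (b : ℝ) ≤ 4 := by exact_mod_cast hb4
    linarith
  have hbulk := piecesW_bound c.nA c.mA c.KA hnA (q := c.q) (D := weilIncrement G) 0 c.cuts c.pieceB le_rfl hcuts
    h8 hlen (fun t ht ↦ hDq t (by rw [hlastR] at ht; exact_mod_cast ht))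
    (fun t ht ↦ hq t (by rw [hlastR] at ht; exact_mod_cast ht)) hpieces
  rw [hlastR] at hbulk
  push_cast at hbulk
  obtain ⟨hintA, hA⟩ := hbulk
  have hintA' : IntegrableOn (fun t ↦ weilArchDensity t * weilIncrement G t) (Set.Ioc (0 : ℝ) ((2 * b : ℚ) : ℝ)) := by
    push_cast; exact hintA
  -- tail
  have h2b0 : (0 : ℚ) < 2 * b := by positivity
  obtain ⟨hintW, _⟩ := setIntegral_Ioi_weilArchDensity_le c.Kt (c := ((2 * b : ℚ) : ℝ)) (by exact_mod_cast h2b0)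
  have hT := setIntegral_Ioi_weilArchDensity_le_archTailQ c.Kt hnt h2b0 htail1
  have hDtail : EqOn (fun t ↦ weilArchDensity t * weilIncrement G t) (fun t ↦ 2 * Nm * weilArchDensity t)
      (Set.Ioi ((2 * b : ℚ) : ℝ)) := fun t ht ↦ by
    simp only
    rw [weilIncrement_polyWitness_eq_of_lt hodd hb0 (by push_cast at ht; exact ht)]
    ring
  have hintW' : IntegrableOn (fun t ↦ 2 * Nm * weilArchDensity t) (Set.Ioi ((2 * b : ℚ) : ℝ)) :=
    hintW.const_mul (2 * Nm)
  have hintT : IntegrableOn (fun t ↦ weilArchDensity t * weilIncrement G t) (Set.Ioi ((2 * b : ℚ) : ℝ)) :=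
    hintW'.congr_fun hDtail.symm measurableSet_Ioi
  have hTail : ∫ t in Set.Ioi ((2 * b : ℚ) : ℝ), weilArchDensity t * weilIncrement G t ≤
      2 * Nm * archTailQ (2 * b) c.Kt c.nt := by
    rw [setIntegral_congr_fun measurableSet_Ioi hDtail, integral_const_mul]
    exact mul_le_mul_of_nonneg_left hT (by positivity)
  -- the whole half-line
  have hunion : Set.Ioc (0 : ℝ) ((2 * b : ℚ) : ℝ) ∪ Set.Ioi ((2 * b : ℚ) : ℝ) = Set.Ioi (0 : ℝ) :=
    Set.Ioc_union_Ioi_eq_Ioi (by exact_mod_cast h2b0.le)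
  have hfin : IntegrableOn (fun t ↦ weilArchDensity t * weilIncrement G t) (Set.Ioi (0 : ℝ)) := by
    rw [← hunion]; exact hintA'.union hintT
  have hInt : ∫ t in Set.Ioi (0 : ℝ), weilArchDensity t * weilIncrement G t
      ≤ (sumQ c.pieceB : ℝ) + 2 * Nm * archTailQ (2 * b) c.Kt c.nt := by
    rw [← hunion, setIntegral_union Ioc_disjoint_Ioi_same measurableSet_Ioi hintA' hintT]
    refine add_le_add ?_ hTail
    push_cast; exact hA
  -- the polar moment is only a credit
  have hpol : (0 : ℝ) ≤ ‖weilMellin G 1‖ ^ 2 := by positivity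
  -- the constant
  have hCS : (c0 : ℝ) + 2 * atomWloSum c.atoms ≤ semilocalWindowConstant S N := by
    unfold semilocalWindowConstant semilocalCoeffSum
    rw [sum_range_eq_atoms_sum (h := fun n ↦ weilSemilocalCoeff S n) hnodup hsub hcover]
    have hw := atomWloSum_le c.atoms (fun na hna ↦ (hencl na hna).2.2.1)
    linarith
  -- assemble
  have hfinal' : ((c.atomB + sumQ c.pieceB + 2 * LQ.normSq p b * archTailQ (2 * b) c.Kt c.nt : ℚ) : ℝ) <
      c.rhsWQ c0 := by exact_mod_cast hfinal
  push_cast at hfinal'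
  have hrhs : (c.rhsWQ c0 : ℝ) ≤ semilocalWindowConstant S N * (∫ x, ‖G x‖ ^ 2) + 2 * ‖weilMellin G 1‖ ^ 2 := by
    rw [WeilNegCertP.rhsWQ, hN]; push_cast
    have : ((c0 : ℝ) + 2 * atomWloSum c.atoms) * Nm ≤ semilocalWindowConstant S N * Nm :=
      mul_le_mul_of_nonneg_right hCS hN0
    linarith
  have hlt : semilocalAtomEnergy S N G + (∫ t in Set.Ioi (0 : ℝ), weilArchDensity t * weilIncrement G t) <
      semilocalWindowConstant S N * (∫ x, ‖G x‖ ^ 2) + 2 * ‖weilMellin G 1‖ ^ 2 := by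
    linarith
  exact weilSemilocalThreshold_le_of_markovWitness_window S N hW hfin hlt hbwin

/-- Soundness of the wide certificate with the sharp constant `c0SharpQ`. -/
theorem weilSemilocalThreshold_le_of_checkW_sharp (c : WeilNegCertP) {S : Finset ℕ} {N : ℕ}
    (henc : AtomsEnclose S N c.atoms c.logSuccLo) (hmain : c.checkMainW c0SharpQ = true)
    (hat : c.checkAtoms = true) (hpieces : ∀ i, i < c.cuts.length → c.checkPieceW i = true) :
    weilSemilocalThreshold S ≤ (c.b : ℝ) :=
  weilSemilocalThreshold_le_of_checkW c henc c0SharpQ_le hmain hat hpieces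

end Summit.RiemannHypothesis.RiemannHypothesis.Theorems.SemilocalPolyWitness

end
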